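import Mathlib
import Literature.AlgebraicGeometry.Resolution.SeparablyDefectlessDenseDescent
import HarnessLib

/-!
# `k(t)` is dense in a discretely valued rational function field (`stub_discrete_isDenseIn`)

Stub of the birth line of the crux `ShadowsUniformize` (route `AbhyankarShadows`), discrete
branch (Knaf–Kuhlmann 2009, Thm. 1.5 / p. 5: at a discrete rational place the function field
`K` lies in the completion `k((t))` of `k(t)`, `t` a uniformizer).

Setting (ambient rendering of `ValuedFunctionFields.lean`): one valued field `(Ω, V)`, subfields
`k' ≤ K'` of `Ω` with `k' ⊆ V` (constants), `t ∈ K'` with `v t < 1` such that every non-zero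
value of `K'` is an integral power of `v t` (`hdisc`), and `K'` RATIONAL: every `y ∈ V ∩ K'` is
congruent to a constant modulo the maximal ideal (`hrat`).

Claim: `k'(t) = Subfield.closure (k' ∪ {t})` is dense in `K'` (`IsDenseIn`): for `y, c ∈ K'`,
`c ≠ 0`, some `z ∈ k'(t)` has `v (y - z) < v c`.

Proof (`t`-adic expansion). If `t = 0` then every non-zero element of `K'` has value `1`, so
`K' ⊆ V` and `hrat` answers the claim with a constant. If `t ≠ 0`: for `w ∈ V ∩ K'`, `hrat`
gives a constant `c₀` with `v (w - c₀) < 1`, and discreteness forces `v (w - c₀) ≤ v t`, so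
`w = c₀ + t w₁` with `w₁ ∈ V ∩ K'`; iterating, `w ≡ q (mod tᴺ V)` for a polynomial `q` in `t`
with constant coefficients (`exists_sub_eq_pow_mul_of_discreteRational`). A general `y ∈ K'` is
first multiplied by a power `tⁿ` into `V`; then `z := q / tⁿ` works as soon as
`(v t)ᴺ < v (c tⁿ)`, which holds for `N` large since `v (c tⁿ)` is itself an integral power of
`v t`.
-/

-- single-problem summit: the doubled namespace component is forced
set_option linter.dupNamespace false

open Literature.AlgebraicGeometry.Resolution

namespace Summit.ResolutionOfSingularities.ResolutionOfSingularities.Theorems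

/-- One step of the `t`-adic expansion, iterated `N` times: in the setting of
`stub_discrete_isDenseIn` with `t ≠ 0`, every `w ∈ V ∩ K'` is congruent modulo `tᴺ · (V ∩ K')`
to an element of `k'(t)`. [folklore] -/
theorem exists_sub_eq_pow_mul_of_discreteRational {Ω : Type} [Field Ω] (V : ValuationSubring Ω)
    (k' K' : Subfield Ω) (t : Ω) (hkK : k' ≤ K') (ht : t ∈ K') (ht0 : t ≠ 0)
    (ht1 : V.valuation t < 1) (hrat : ∀ y ∈ K', y ∈ V → ∃ c ∈ k', V.valuation (y - c) < 1)
    (hdisc : ∀ y ∈ K', y ≠ 0 → ∃ m : ℤ, V.valuation y = V.valuation t ^ m)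
    (N : ℕ) (w : Ω) (hwK : w ∈ K') (hwV : w ∈ V) :
    ∃ q ∈ Subfield.closure ((k' : Set Ω) ∪ {t}), ∃ w' ∈ K', w' ∈ V ∧ w - q = t ^ N * w' := by
  have htA : t ∈ Subfield.closure ((k' : Set Ω) ∪ {t}) :=
    Subfield.subset_closure (Or.inr rfl)
  have hvt0 : 0 < V.valuation t := (Valuation.pos_iff _).mpr ht0
  induction N with
  | zero => exact ⟨0, Subfield.zero_mem _, w, hwK, hwV, by rw [sub_zero, pow_zero, one_mul]⟩
  | succ N ih =>
    obtain ⟨q, hqA, w', hw'K, hw'V, hEq⟩ := ih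
    obtain ⟨c₀, hc₀k, hc₀⟩ := hrat w' hw'K hw'V
    have hdK : w' - c₀ ∈ K' := K'.sub_mem hw'K (hkK hc₀k)
    -- discreteness: a value `< 1` of `K'` is `≤ v t`
    have hle : V.valuation (w' - c₀) ≤ V.valuation t := by
      by_cases hd0 : w' - c₀ = 0
      · rw [hd0, map_zero]
        exact zero_le
      · obtain ⟨j, hj⟩ := hdisc _ hdK hd0
        rw [hj] at hc₀ ⊢
        have hj1 : (1 : ℤ) ≤ j :=
          (zpow_lt_one_iff_right_of_lt_one₀ hvt0 ht1).mp hc₀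
        calc V.valuation t ^ j ≤ V.valuation t ^ (1 : ℤ) :=
              zpow_le_zpow_right_of_le_one₀ hvt0 ht1.le hj1
          _ = V.valuation t := zpow_one _
    refine ⟨q + t ^ N * c₀, Subfield.add_mem _ hqA (Subfield.mul_mem _
      (Subfield.pow_mem _ htA N) (Subfield.subset_closure (Or.inl hc₀k))), (w' - c₀) / t,
      K'.div_mem hdK ht, ?_, ?_⟩
    · rw [← V.valuation_le_one_iff, map_div₀]
      exact div_le_one_of_le₀ hle zero_le
    · rw [pow_succ, mul_assoc, mul_div_cancel₀ _ ht0, mul_sub, ← hEq]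
      ring

/-- **`k'(t)` is dense in `K'` at a discrete rational place** (Knaf–Kuhlmann 2009, p. 5: the
function field lies in the completion of the rational function field of a uniformizer): if
`k' ≤ K'` are subfields of the valued field `(Ω, V)` with `k' ⊆ V`, `t ∈ K'` has `v t < 1`,
every element of `V ∩ K'` is congruent to a constant modulo the maximal ideal, and every
non-zero value of `K'` is an integral power of `v t`, then `Subfield.closure (k' ∪ {t})` is dense
in `K'`. [cite: KnafKuhlmann2009, Thm. 1.5] -/
theorem stub_discrete_isDenseIn {Ω : Type} [Field Ω] (V : ValuationSubring Ω)
    (k' K' : Subfield Ω) (t : Ω) (hkK : k' ≤ K') (hkV : (k' : Set Ω) ⊆ V) (ht : t ∈ K')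
    (ht1 : V.valuation t < 1) (hrat : ∀ y ∈ K', y ∈ V → ∃ c ∈ k', V.valuation (y - c) < 1)
    (hdisc : ∀ y ∈ K', y ≠ 0 → ∃ m : ℤ, V.valuation y = V.valuation t ^ m) :
    IsDenseIn V (Subfield.closure ((k' : Set Ω) ∪ {t})) K' := by
  have _hkV := hkV
  intro y hy c hc hc0
  have hkA : (k' : Set Ω) ⊆ Subfield.closure ((k' : Set Ω) ∪ {t}) :=
    fun x hx => Subfield.subset_closure (Or.inl hx)
  by_cases ht0 : t = 0
  · -- degenerate case: all non-zero values of `K'` are `1`, so `K' ⊆ V`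
    have hval : ∀ x ∈ K', x ≠ 0 → V.valuation x = 1 := fun x hx hx0 => by
      obtain ⟨m, hm⟩ := hdisc x hx hx0
      rw [ht0, map_zero] at hm
      rcases eq_or_ne m 0 with rfl | hm0
      · rw [hm, zpow_zero]
      · rw [zero_zpow m hm0] at hm
        exact absurd ((Valuation.zero_iff _).mp hm) hx0
    have hyV : y ∈ V := by
      rw [← V.valuation_le_one_iff]
      rcases eq_or_ne y 0 with rfl | hy0
      · rw [map_zero]; exact zero_le
      · exact (hval y hy hy0).le
    obtain ⟨c₀, hc₀k, hc₀⟩ := hrat y hy hyV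
    exact ⟨c₀, hkA hc₀k, by rwa [hval c hc hc0]⟩
  -- main case `t ≠ 0`
  have hvt0 : 0 < V.valuation t := (Valuation.pos_iff _).mpr ht0
  have htA : t ∈ Subfield.closure ((k' : Set Ω) ∪ {t}) :=
    Subfield.subset_closure (Or.inr rfl)
  -- move `y` into `V` by a power of `t`
  obtain ⟨n, hn⟩ : ∃ n : ℕ, y * t ^ n ∈ V := by
    rcases eq_or_ne y 0 with rfl | hy0
    · exact ⟨0, by rw [zero_mul]; exact V.zero_mem⟩
    obtain ⟨m, hm⟩ := hdisc y hy hy0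
    obtain ⟨n, rfl | rfl⟩ := Int.eq_nat_or_neg m
    · refine ⟨0, ?_⟩
      rw [← V.valuation_le_one_iff, pow_zero, mul_one, hm, zpow_natCast]
      exact pow_le_one₀ zero_le ht1.le
    · refine ⟨n, ?_⟩
      rw [← V.valuation_le_one_iff, map_mul, map_pow, hm, zpow_neg, zpow_natCast,
        inv_mul_cancel₀ (pow_ne_zero n hvt0.ne')]
  -- the target precision, as a power of `v t`
  have hctn : c * t ^ n ∈ K' := K'.mul_mem hc (K'.pow_mem ht n)
  have hctn0 : c * t ^ n ≠ 0 := mul_ne_zero hc0 (pow_ne_zero n ht0)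
  obtain ⟨m, hm⟩ := hdisc _ hctn hctn0
  obtain ⟨q, hqA, w', -, hw'V, hEq⟩ := exists_sub_eq_pow_mul_of_discreteRational V k' K' t hkK
    ht ht0 ht1 hrat hdisc (m.toNat + 1) (y * t ^ n) (K'.mul_mem hy (K'.pow_mem ht n)) hn
  refine ⟨q / t ^ n, Subfield.div_mem _ hqA (Subfield.pow_mem _ htA n), ?_⟩
  -- compare after multiplying by `tⁿ`
  have htn0 : 0 < V.valuation (t ^ n) := by
    rw [map_pow]; exact pow_pos hvt0 n
  rw [← mul_lt_mul_iff_left₀ htn0, ← map_mul, ← map_mul, sub_mul,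
    div_mul_cancel₀ _ (pow_ne_zero n ht0), hEq, hm, map_mul, map_pow]
  calc V.valuation t ^ (m.toNat + 1) * V.valuation w'
      ≤ V.valuation t ^ (m.toNat + 1) * 1 :=
        mul_le_mul_right ((V.valuation_le_one_iff _).mpr hw'V) _
    _ = V.valuation t ^ ((m.toNat + 1 : ℕ) : ℤ) := by rw [mul_one, zpow_natCast]
    _ < V.valuation t ^ m := by
        refine zpow_lt_zpow_right_of_lt_one₀ hvt0 ht1 ?_
        have := Int.self_le_toNat m
        push_cast
        omega

end Summit.ResolutionOfSingularities.ResolutionOfSingularities.Theorems
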